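import Summits.CriticalPhenomena.CardyFormulaZ2.Theorems.CardyBoundaryCoulombGasBoundaryDefectGaussianRS17ConfigsNonemptyPart1
import Summits.CriticalPhenomena.CardyFormulaZ2.Theorems.CardyBoundaryCoulombGasBoundaryDefectGaussianRS17ConfigsNonemptyPart7
import Summits.CriticalPhenomena.CardyFormulaZ2.Theorems.CardyBoundaryCoulombGasBoundaryDefectGaussianRS17ConfigsNonemptyPart8

/-!
# Stub `s17_eventually_configsNonempty` of the D2 completion (line
# `rainbow-monomials-in-excursion-kernels`, crux `BoundaryDefectGaussianR`,
# stmt-CriticalPhenomena-14132) — Part 9: the prescribed cells near a flat insertion point are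
# cells of the straight strip

Near an insertion point `x₀` (with exterior direction `k₀`: `x₀ + dir k₀ ∉ V`) at which `V` is
FLAT at radius `R` — `V` is the half-plane `⟨v - x₀, dir k₀⟩ ≤ 0` on the lattice ball of radius `R`
(`cb_mem`, the pairing form of `flat_frame`, Part 31) — every lattice point reads
`v = x₀ + j • dir (k₀+1) + i • dir k₀` with `j = ⟨v - x₀, dir (k₀+1)⟩` (the COLUMN) and
`i = ⟨v - x₀, dir k₀⟩` (the ROW) (`cb_decomp`). A point of `V` with a lattice or diagonal
neighbour outside `V` sits in row `0` (`cb_row_zero`). Consequently (classification of the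
prescribed cells of the jump collar of an admissible `ι` near `x₀`, by their doubled positions):

* `cb_face_class` — a non-free face-cell is the gap face `gapFace (x₀ + a • dir (k₀+1), k₀)` of a
  wall dart (`face_at_straight`, Part 43);
* `cb_vertex_class` — a non-free vertex-cell is a wall vertex `x₀ + a • dir (k₀+1)` lying on the
  arc (row `0`) or the ghost `x₀ + a • dir (k₀+1) + dir k₀` above one (row `1`).
Part 10 reads their levels off the straight run of the cycle through `x₀` (Part 8). All [folklore].
-/

namespace Summit.CriticalPhenomena.CardyFormulaZ2.Cruxes.BoundaryDefectGaussianR.RainbowMonomialsInExcursionKernels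

open Literature.Probability.LatticeModels Literature.Probability.LatticeModels.CollarLegModel

/-! ### Flat coordinates -/

/-- **Column / row decomposition**: `v = x₀ + ⟨v - x₀, dir (k₀+1)⟩ • dir (k₀+1) + ⟨v - x₀, dir k₀⟩ • dir k₀`.
[folklore] -/
theorem cb_decomp (x₀ v : ℤ × ℤ) (k₀ : Fin 4) :
    v = x₀ + ((v.1 - x₀.1) * (dir (k₀ + 1)).1 + (v.2 - x₀.2) * (dir (k₀ + 1)).2) • dir (k₀ + 1) +
      ((v.1 - x₀.1) * (dir k₀).1 + (v.2 - x₀.2) * (dir k₀).2) • dir k₀ := by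
  obtain ⟨a, b⟩ := x₀
  obtain ⟨c, d⟩ := v
  fin_cases k₀ <;> simp [dir]

/-- The squared distance in flat coordinates. [folklore] -/
theorem cb_sq (x₀ v : ℤ × ℤ) (k₀ : Fin 4) :
    ((v.1 - x₀.1) * (dir k₀).1 + (v.2 - x₀.2) * (dir k₀).2) ^ 2 +
      ((v.1 - x₀.1) * (dir (k₀ + 1)).1 + (v.2 - x₀.2) * (dir (k₀ + 1)).2) ^ 2 =
      (v.1 - x₀.1) ^ 2 + (v.2 - x₀.2) ^ 2 := by
  obtain ⟨a, b⟩ := x₀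
  obtain ⟨c, d⟩ := v
  fin_cases k₀ <;> simp [dir] <;> ring

/-- Pairings are additive. [folklore] -/
theorem cb_pair_sub (x₀ v w n : ℤ × ℤ) :
    ((w.1 - x₀.1) * n.1 + (w.2 - x₀.2) * n.2) - ((v.1 - x₀.1) * n.1 + (v.2 - x₀.2) * n.2) =
      (w.1 - v.1) * n.1 + (w.2 - v.2) * n.2 := by
  ring

/-- A point of row `0` is the wall vertex of its column. [folklore] -/
theorem cb_wall_of_row_zero (x₀ : ℤ × ℤ) (k₀ : Fin 4) {v : ℤ × ℤ}
    (h0 : (v.1 - x₀.1) * (dir k₀).1 + (v.2 - x₀.2) * (dir k₀).2 = 0) :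
    v = x₀ + ((v.1 - x₀.1) * (dir (k₀ + 1)).1 + (v.2 - x₀.2) * (dir (k₀ + 1)).2) • dir (k₀ + 1) := by
  have h := cb_decomp x₀ v k₀
  rw [h0, zero_smul, add_zero] at h
  exact h

/-- A point of row `1` is the ghost above the wall vertex of its column. [folklore] -/
theorem cb_ghost_of_row_one (x₀ : ℤ × ℤ) (k₀ : Fin 4) {v : ℤ × ℤ}
    (h1 : (v.1 - x₀.1) * (dir k₀).1 + (v.2 - x₀.2) * (dir k₀).2 = 1) :
    v = x₀ + ((v.1 - x₀.1) * (dir (k₀ + 1)).1 + (v.2 - x₀.2) * (dir (k₀ + 1)).2) • dir (k₀ + 1) +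
      dir k₀ := by
  have h := cb_decomp x₀ v k₀
  rw [h1, one_smul] at h
  exact h

section Flat

variable {V : Finset (ℤ × ℤ)} {x₀ dvec : ℤ × ℤ} {k₀ : Fin 4} {R : ℤ}
  (hd : dvec = (1, 0) ∨ dvec = (-1, 0) ∨ dvec = (0, 1) ∨ dvec = (0, -1))
  (hflat : ∀ v : ℤ × ℤ, (v.1 - x₀.1) ^ 2 + (v.2 - x₀.2) ^ 2 ≤ R ^ 2 →
    (v ∈ V ↔ 0 ≤ (v.1 - x₀.1) * dvec.1 + (v.2 - x₀.2) * dvec.2))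
  (hR : 1 ≤ R) (hk₀ : x₀ + dir k₀ ∉ V)
include hd hflat hR hk₀

/-- **Membership by row**: within the flat ball, `v ∈ V ↔ ⟨v - x₀, dir k₀⟩ ≤ 0`. [folklore] -/
theorem cb_mem (v : ℤ × ℤ) (hv : (v.1 - x₀.1) ^ 2 + (v.2 - x₀.2) ^ 2 ≤ R ^ 2) :
    v ∈ V ↔ (v.1 - x₀.1) * (dir k₀).1 + (v.2 - x₀.2) * (dir k₀).2 ≤ 0 := by
  have h := flat_frame hd hflat hR hk₀ ((v.1 - x₀.1) * (dir k₀).1 + (v.2 - x₀.2) * (dir k₀).2)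
    ((v.1 - x₀.1) * (dir (k₀ + 1)).1 + (v.2 - x₀.2) * (dir (k₀ + 1)).2) (by rw [cb_sq]; exact hv)
  rwa [← cb_decomp x₀ v k₀] at h

/-- **Boundary points sit in row `0`**: a point of `V` with a point outside `V` within sup-distance
`1` of it (both in the flat ball) has row `⟨v - x₀, dir k₀⟩ = 0`, and the outside point row `1`.
[folklore] -/
theorem cb_row_zero {v w : ℤ × ℤ} (hv : v ∈ V) (hw : w ∉ V)
    (hvb : (v.1 - x₀.1) ^ 2 + (v.2 - x₀.2) ^ 2 ≤ R ^ 2) (hwb : (w.1 - x₀.1) ^ 2 + (w.2 - x₀.2) ^ 2 ≤ R ^ 2)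
    (h1 : |w.1 - v.1| ≤ 1) (h2 : |w.2 - v.2| ≤ 1) :
    (v.1 - x₀.1) * (dir k₀).1 + (v.2 - x₀.2) * (dir k₀).2 = 0 ∧
      (w.1 - x₀.1) * (dir k₀).1 + (w.2 - x₀.2) * (dir k₀).2 = 1 := by
  have a1 := (cb_mem hd hflat hR hk₀ v hvb).1 hv
  have a2 : ¬ ((w.1 - x₀.1) * (dir k₀).1 + (w.2 - x₀.2) * (dir k₀).2 ≤ 0) :=
    fun h => hw ((cb_mem hd hflat hR hk₀ w hwb).2 h)
  have a3 := (lc_pair_sup k₀ (w - v)).1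
  simp only [Prod.fst_sub, Prod.snd_sub] at a3
  have a4 : max |w.1 - v.1| |w.2 - v.2| ≤ 1 := max_le h1 h2
  have a5 := abs_le.1 (a3.trans a4)
  have e := cb_pair_sub x₀ v w (dir k₀)
  constructor <;> linarith [a5.1, a5.2]

end Flat

/-! ### Corners of a face are close to each other -/

/-- Two corners of one unit face are within sup-distance `1`. [folklore] -/
theorem cb_corners_close {f v w : ℤ × ℤ} (hv : f ∈ SixVertex.vertexFaces v)
    (hw : w ∈ SixVertex.faceCorners f) : |w.1 - v.1| ≤ 1 ∧ |w.2 - v.2| ≤ 1 := by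
  obtain ⟨e1, e2⟩ := dt_vertexFaces_coord hv
  simp only [SixVertex.faceCorners, Finset.mem_insert, Finset.mem_singleton] at hw
  obtain ⟨a, b⟩ := f
  obtain ⟨c, d⟩ := w
  simp only [Prod.mk.injEq] at hw e1 e2 ⊢
  rw [abs_le, abs_le]
  omega

/-- A non-interior face of `V` has a corner outside `V`. [folklore] -/
theorem cb_exists_corner_not_mem {V : Finset (ℤ × ℤ)} {f : ℤ × ℤ} (hf : f ∈ SixVertex.faces V)
    (hni : f ∉ interiorFaces V) : ∃ w ∈ SixVertex.faceCorners f, w ∉ V := by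
  by_contra h
  push Not at h
  exact hni (Finset.mem_filter.2 ⟨hf, fun w hw => h w hw⟩)

/-! ### Classification of the prescribed cells near a flat insertion point -/

section Classify

variable (ι : LegInsertionData) (V : Finset (ℤ × ℤ)) {d₀ : Dart} (hadm : ι.IsAdmissible V)
  (h0 : outDart V ι.sink = some d₀) {st : ℕ → WalkState}
  (hst : ∀ t, st t = List.foldl (fun s d => s.step (ι.startAt V d)) ι.init ((cycle V d₀).take t))
  {x₀ dvec : ℤ × ℤ} {k₀ : Fin 4} {R : ℤ}
  (hd : dvec = (1, 0) ∨ dvec = (-1, 0) ∨ dvec = (0, 1) ∨ dvec = (0, -1))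
  (hflat : ∀ v : ℤ × ℤ, (v.1 - x₀.1) ^ 2 + (v.2 - x₀.2) ^ 2 ≤ R ^ 2 →
    (v ∈ V ↔ 0 ≤ (v.1 - x₀.1) * dvec.1 + (v.2 - x₀.2) * dvec.2))
  (hR : 1 ≤ R) (hk₀ : x₀ + dir k₀ ∉ V)

include hd hflat hR hk₀ in
/-- **Non-free face-cells near a flat point are gap faces of wall darts.** If the doubled position
`2 f + (1,1)` of a non-free face-cell `f` is within sup-distance `2 A` of `2 x₀` and
`2 (A + 3)² ≤ R²`, then `f = gapFace (x₀ + a • dir (k₀+1), k₀)` with `|a| ≤ A + 2`. [folklore] -/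
theorem cb_face_class {A : ℤ} (hA : 0 ≤ A) (hAR : 2 * (A + 3) ^ 2 ≤ R ^ 2) {f : ℤ × ℤ}
    (hfc : f ∈ (ι.model V).faceCells) (hff : (f, true) ∉ (ι.model V).freeCells)
    (hnear : |2 * f.1 + 1 - 2 * x₀.1| ≤ 2 * A ∧ |2 * f.2 + 1 - 2 * x₀.2| ≤ 2 * A) :
    ∃ a : ℤ, |a| ≤ A + 2 ∧ f = gapFace (x₀ + a • dir (k₀ + 1), k₀) := by
  obtain ⟨hni, -⟩ := not_mem_of_not_mem_freeCells (ι.model V) hff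
  have hfV : f ∈ SixVertex.faces V := hfc
  obtain ⟨v, hvV, hfv⟩ := Finset.mem_biUnion.1 hfV
  obtain ⟨w, hwf, hwV⟩ := cb_exists_corner_not_mem hfV hni
  obtain ⟨c1, c2⟩ := cb_corners_close hfv hwf
  obtain ⟨e1, e2⟩ := dt_vertexFaces_coord hfv
  obtain ⟨n1, n2⟩ := hnear
  have c1' := abs_le.1 c1
  have c2' := abs_le.1 c2
  rw [abs_le] at n1 n2
  -- distances
  have hv1 : |v.1 - x₀.1| ≤ A + 1 := by rw [abs_le]; omega
  have hv2 : |v.2 - x₀.2| ≤ A + 1 := by rw [abs_le]; omega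
  have hw1 : |w.1 - x₀.1| ≤ A + 2 := by rw [abs_le]; omega
  have hw2 : |w.2 - x₀.2| ≤ A + 2 := by rw [abs_le]; omega
  have sq : ∀ (p : ℤ × ℤ) (B : ℤ), |p.1 - x₀.1| ≤ B → |p.2 - x₀.2| ≤ B → 0 ≤ B → B ≤ A + 3 →
      (p.1 - x₀.1) ^ 2 + (p.2 - x₀.2) ^ 2 ≤ R ^ 2 := by
    intro p B h1 h2 hB hBA
    have q1 : (p.1 - x₀.1) ^ 2 ≤ B ^ 2 := by rw [← sq_abs]; exact pow_le_pow_left₀ (abs_nonneg _) h1 2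
    have q2 : (p.2 - x₀.2) ^ 2 ≤ B ^ 2 := by rw [← sq_abs]; exact pow_le_pow_left₀ (abs_nonneg _) h2 2
    nlinarith
  obtain ⟨hrow, -⟩ := cb_row_zero hd hflat hR hk₀ hvV hwV (sq v (A + 1) hv1 hv2 (by omega) (by omega))
    (sq w (A + 2) hw1 hw2 (by omega) (by omega)) c1 c2
  -- `v` is the wall vertex of column `j`
  set j : ℤ := (v.1 - x₀.1) * (dir (k₀ + 1)).1 + (v.2 - x₀.2) * (dir (k₀ + 1)).2 with hj
  have hvz : v = x₀ + j • dir (k₀ + 1) := cb_wall_of_row_zero x₀ k₀ hrow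
  have hjb : |j| ≤ A + 1 := ((lc_pair_sup k₀ (v - x₀)).2).trans (max_le hv1 hv2)
  -- the strip memberships around `v`
  have M : ∀ a b : ℤ, |a - j| ≤ 1 → -1 ≤ b → b ≤ 0 → x₀ + a • dir (k₀ + 1) + b • dir k₀ ∈ V := by
    intro a b ha hb1 hb0
    have hab : b ^ 2 + a ^ 2 ≤ R ^ 2 := by
      rw [abs_le] at ha hjb
      nlinarith
    exact (flat_frame hd hflat hR hk₀ b a hab).2 hb0
  have m0 : x₀ + j • dir (k₀ + 1) ∈ V := by
    have := M j 0 (by simp) (by norm_num) le_rfl; simpa using this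
  have mE : x₀ + j • dir (k₀ + 1) + dir (k₀ + 1) ∈ V := by
    have := M (j + 1) 0 (by simp) (by norm_num) le_rfl
    rw [zero_smul, add_zero, add_smul, one_smul, ← add_assoc] at this; exact this
  have mS : x₀ + j • dir (k₀ + 1) - dir k₀ ∈ V := by
    have := M j (-1) (by simp) le_rfl (by norm_num)
    rw [neg_one_smul, ← sub_eq_add_neg] at this; exact this
  have mW : x₀ + j • dir (k₀ + 1) - dir (k₀ + 1) ∈ V := by
    have := M (j - 1) 0 (by simp) (by norm_num) le_rfl
    rw [zero_smul, add_zero, sub_smul, one_smul, ← add_sub_assoc] at this; exact this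
  have mSW : x₀ + j • dir (k₀ + 1) - dir (k₀ + 1) - dir k₀ ∈ V := by
    have := M (j - 1) (-1) (by simp) le_rfl (by norm_num)
    rw [neg_one_smul, ← sub_eq_add_neg, sub_smul, one_smul, ← add_sub_assoc] at this; exact this
  have mSE : x₀ + j • dir (k₀ + 1) + dir (k₀ + 1) - dir k₀ ∈ V := by
    have := M (j + 1) (-1) (by simp) le_rfl (by norm_num)
    rw [neg_one_smul, ← sub_eq_add_neg, add_smul, one_smul, ← add_assoc] at this; exact this
  rw [hvz] at hfv
  rcases face_at_straight m0 mE mS mW mSW mSE hfv hni with h | h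
  · exact ⟨j, by linarith [hjb], h⟩
  · refine ⟨j - 1, ?_, by rw [h, sub_smul, one_smul, add_sub_assoc]⟩
    rw [abs_le] at hjb ⊢; omega

include hadm h0 hst hd hflat hR hk₀ in
/-- **Non-free vertex-cells near a flat point are wall vertices on the arc or ghosts above the
wall.** If the doubled position `2 x` of a non-free vertex-cell `x` is within sup-distance `2 A`
of `2 x₀` and `2 (A + 2)² ≤ R²`, then `x = x₀ + a • dir (k₀+1)` is an arc vertex, or
`x = x₀ + a • dir (k₀+1) + dir k₀` is a ghost, with `|a| ≤ A`. [folklore] -/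
theorem cb_vertex_class {A : ℤ} (hA : 0 ≤ A) (hAR : 2 * (A + 2) ^ 2 ≤ R ^ 2) {x : ℤ × ℤ}
    (hx : x ∈ (ι.model V).vertexCells) (hxf : (x, false) ∉ (ι.model V).freeCells)
    (hnear : |2 * x.1 - 2 * x₀.1| ≤ 2 * A ∧ |2 * x.2 - 2 * x₀.2| ≤ 2 * A) :
    ∃ a : ℤ, |a| ≤ A ∧
      ((x = x₀ + a • dir (k₀ + 1) ∧ x ∈ (ι.collar V).arc) ∨
        (x = x₀ + a • dir (k₀ + 1) + dir k₀ ∧ x ∈ (ι.model V).ghosts)) := by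
  obtain ⟨n1, n2⟩ := hnear
  rw [abs_le] at n1 n2
  have hx1 : |x.1 - x₀.1| ≤ A := by rw [abs_le]; omega
  have hx2 : |x.2 - x₀.2| ≤ A := by rw [abs_le]; omega
  have sq : ∀ (p : ℤ × ℤ) (B : ℤ), |p.1 - x₀.1| ≤ B → |p.2 - x₀.2| ≤ B → 0 ≤ B → B ≤ A + 2 →
      (p.1 - x₀.1) ^ 2 + (p.2 - x₀.2) ^ 2 ≤ R ^ 2 := by
    intro p B h1 h2 hB hBA
    have q1 : (p.1 - x₀.1) ^ 2 ≤ B ^ 2 := by rw [← sq_abs]; exact pow_le_pow_left₀ (abs_nonneg _) h1 2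
    have q2 : (p.2 - x₀.2) ^ 2 ≤ B ^ 2 := by rw [← sq_abs]; exact pow_le_pow_left₀ (abs_nonneg _) h2 2
    nlinarith
  set j : ℤ := (x.1 - x₀.1) * (dir (k₀ + 1)).1 + (x.2 - x₀.2) * (dir (k₀ + 1)).2 with hj
  have hjb : |j| ≤ A := ((lc_pair_sup k₀ (x - x₀)).2).trans (max_le hx1 hx2)
  rcases mem_arc_or_ghosts_of_not_mem_freeCells (ι.model V) hx hxf with ⟨hxV, harc⟩ | ⟨hxV, hg⟩
  · -- an arc vertex: it carries an exterior dart, so it sits in row `0`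
    change x ∈ (ι.collar V).arc at harc
    obtain ⟨t, ht, -, hxt⟩ := (mem_collar_arc_iff ι V h0 hst).1 harc
    obtain ⟨-, hout⟩ := cycle_getElem_exterior ι V hadm h0 ht
    rw [hxt] at hout
    have hw : |(x + dir ((cycle V d₀)[t]).2).1 - x.1| ≤ 1 ∧ |(x + dir ((cycle V d₀)[t]).2).2 - x.2| ≤ 1 := by
      obtain ⟨a, b⟩ := x
      generalize ((cycle V d₀)[t]).2 = kk; fin_cases kk <;> simp [dir]
    have hw1 : |(x + dir ((cycle V d₀)[t]).2).1 - x₀.1| ≤ A + 1 := by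
      have := hw.1; rw [abs_le] at this hx1 ⊢; omega
    have hw2 : |(x + dir ((cycle V d₀)[t]).2).2 - x₀.2| ≤ A + 1 := by
      have := hw.2; rw [abs_le] at this hx2 ⊢; omega
    obtain ⟨hrow, -⟩ := cb_row_zero hd hflat hR hk₀ hxV hout (sq x A hx1 hx2 hA (by omega))
      (sq _ (A + 1) hw1 hw2 (by omega) (by omega)) hw.1 hw.2
    exact ⟨j, hjb, Or.inl ⟨cb_wall_of_row_zero x₀ k₀ hrow, harc⟩⟩
  · -- a ghost: next to a point of `V`, so it sits in row `1`
    change x ∉ V at hxV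
    suffices H : ∃ v ∈ V, |x.1 - v.1| ≤ 1 ∧ |x.2 - v.2| ≤ 1 by
      obtain ⟨v, hvV, c1, c2⟩ := H
      have hv1 : |v.1 - x₀.1| ≤ A + 1 := by rw [abs_le] at c1 hx1 ⊢; omega
      have hv2 : |v.2 - x₀.2| ≤ A + 1 := by rw [abs_le] at c2 hx2 ⊢; omega
      obtain ⟨-, hrow⟩ := cb_row_zero hd hflat hR hk₀ hvV hxV (sq v (A + 1) hv1 hv2 (by omega) (by omega))
        (sq x A hx1 hx2 hA (by omega)) c1 c2
      exact ⟨j, hjb, Or.inr ⟨cb_ghost_of_row_one x₀ k₀ hrow, hg⟩⟩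
    have hg' := (Finset.mem_sdiff.mp hg).1
    rcases Finset.mem_union.mp hg' with h1 | h2
    · obtain ⟨y, hy, hxy⟩ := Finset.mem_biUnion.mp h1
      obtain ⟨-, hyV⟩ := Finset.mem_inter.mp hy
      obtain ⟨m, rfl⟩ := mem_neighbours_iff.mp hxy
      refine ⟨y, hyV, ?_⟩
      obtain ⟨a, b⟩ := y
      fin_cases m <;> simp [dir]
    · obtain ⟨p, hp, hxp⟩ := Finset.mem_biUnion.mp h2
      obtain ⟨-, hpb⟩ := Finset.mem_inter.mp hp
      have hpf : p ∈ SixVertex.faces V := (Finset.mem_filter.mp hpb).1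
      obtain ⟨v, hvV, hpv⟩ := Finset.mem_biUnion.1 hpf
      exact ⟨v, hvV, cb_corners_close hpv hxp⟩

end Classify

/-! ### Registered one-line form -/

/-- **Registered sub-goal `s17_configsNonempty_part9`** of `s17_eventually_configsNonempty`
(stmt-CriticalPhenomena-14132): membership by row near a flat insertion point — if `V` is a
half-plane on the lattice ball of radius `R ≥ 1` about `x₀` and `x₀ + dir k₀ ∉ V`, then on that
ball `v ∈ V ↔ ⟨v - x₀, dir k₀⟩ ≤ 0` (one-line form of `cb_mem`). [folklore] -/
theorem s17_configsNonempty_part9 : ∀ (V : Finset (ℤ × ℤ)) (x₀ dvec : ℤ × ℤ) (k₀ : Fin 4) (R : ℤ), (dvec = (1, 0) ∨ dvec = (-1, 0) ∨ dvec = (0, 1) ∨ dvec = (0, -1)) → (∀ v : ℤ × ℤ, (v.1 - x₀.1) ^ 2 + (v.2 - x₀.2) ^ 2 ≤ R ^ 2 → (v ∈ V ↔ 0 ≤ (v.1 - x₀.1) * dvec.1 + (v.2 - x₀.2) * dvec.2)) → 1 ≤ R → x₀ + Literature.Probability.LatticeModels.CollarLegModel.dir k₀ ∉ V → ∀ (v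 : ℤ × ℤ), (v.1 - x₀.1) ^ 2 + (v.2 - x₀.2) ^ 2 ≤ R ^ 2 → (v ∈ V ↔ (v.1 - x₀.1) * (Literature.Probability.LatticeModels.CollarLegModel.dir k₀).1 + (v.2 - x₀.2) * (Literature.Probability.LatticeModels.CollarLegModel.dir k₀).2 ≤ 0) :=
  fun _ _ _ _ _ hd hflat hR hk₀ v hv => cb_mem hd hflat hR hk₀ v hv

end Summit.CriticalPhenomena.CardyFormulaZ2.Cruxes.BoundaryDefectGaussianR.RainbowMonomialsInExcursionKernels
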